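import Summits.QuantumFields.YangMills.Theorems.BalabanUVNodesN15CurvedGluingCubeAdjointCovariantEntrySandwich
import Summits.QuantumFields.YangMills.Theorems.BalabanUVNodesN15CurvedGluingCubeDressedGeneralGauge
import HarnessLib

/-!
# THE GAUGE-CONJUGATED GRADIENT IS A COVARIANT-SHAPED RIGHT ENTRY: `M_W∘∇^±∘M_{Wᵀ} = M_{R₁}∘∇^± + M_{B₁}` with the pure-gauge transporter `R₁ = W·(Wᵀ∘e^∓)` and its lattice derivative `B₁`
# (FILE 150's product rules), hence FILE 160's per-cube sandwich hypothesis `M_χ∘X_k∘(M_{W_k}∇⁻M_{W_kᵀ})∘M_{h^s} = T′_k∘M_{h^s}` for the adjoint-side dressed cube from FILE 157 ★★ — the entry-2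
# letter `E := ∇⁻_μ` of the print's `𝒢∘∇^{U*}` read in cube `k`'s (3.35) gauge (dag-n15-c g18, FILE 162; N15 = NE2, s1 «background-layer OPERATOR ingredient»)

Cell `pub-ymgap`, seat `pub-ymgap-dag-n15-c` (R134 (a); HUMAN RULING D-0062), generation 18.  `bears_on: R4∕N15 · K3⁸ SpineGivenEndpointR13SepCoPHV (stmt-QuantumFields-27366)`.
Filed `--kind proof --supports stmt-QuantumFields-27366 --as helper` — COUNT-NEUTRAL.  Theorems only; 0 `def`, 0 `sorry`.  Imports BY NAME FILE 157 `…CubeAdjointCovariantEntrySandwich`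
(`comp_covShape_fgrad/bgrad_sandwich`, `cut_sandwich_of_sandwich`, `smoothCutDressed_comp_covShape_bgrad_sandwich`; through it FILE 150 `mmulOp_comp_fgrad_eq`, `mmulOp_comp_bgrad_eq`) and dag-n15-w3
`…CubeDressedGeneralGauge` (vocabulary only); n15-c `mmulOp_comp_mmulOp`.  Nothing in the tree is modified; nothing restated.

WHY (FINDING (ix) of this generation).  FILE 160 glues the conjugated-back cubes `M_{W_kᵀ}X_kM_{W_k}` and reads the GLOBAL right entry `E = ∇⁻_μ` through the cube-gauge sandwich against
`E^{W_k} = M_{W_k}∇⁻_μM_{W_kᵀ}`.  THIS FILE computes `E^{W}` as a covariant-shaped entry — transport `R₁(x) = W(x)W(e⁻¹x)ᵀ` (the pure gauge's bond variable in the adjoint representation, orthogonal,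
entries `≤ 1`) and connection part `B₁ = W·∇(Wᵀ∘e⁻¹)` (bounded by the gauge's one-step oscillation, a (3.35) letter) — so that FILE 157's sandwich, row and defect apply with `R := R₁`, `B := B₁`.

WHAT.  §1 `gaugeConj_bgrad_eq`, `gaugeConj_fgrad_eq`; §2 ★ `comp_gaugeConj_bgrad_sandwich` (generic cube `G` with `G∘∇⁻∘M_χ = T∘M_χ`), ★ `cut_gaugeConj_bgrad_sandwich` (FILE 160's `hE2′` shape
`M_c∘G∘E^W∘M_a = (M_c∘T₂)∘M_a`), ★★ `smoothCutDressed_gaugeConj_bgrad_sandwich` (the instance `G := X°`, `T := Ñ_𝒲∘M_χ̃∘T⁻_N`).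

HONEST FRAMING ∕ LIMITS.  Lattice Leibniz + conjugation algebra; no estimate; nothing of [B5]∕[B6]∕[B9] asserted ((3.34)–(3.35) p.396, (3.42) p.397, (3.64)–(3.65) pp.402–403 = SHAPES).  NE2⁺ NOT PRINTED,
NOT proved; N15 NOT discharged; K3⁸ OPEN, skeleton v7 untouched (0∕2); counts of record UNMOVED by this seat (typed 28∕28 · discharged 7∕28 = 7∕27 excl. NODE O, №245); one finite 𝕋⁴ at fixed
ε — NOT infinite volume, NOT OS on ℝ⁴, NOT a mass gap, NOT Clay; R4 closes the conditional finite-𝕋⁴ rung `BalabanLadder.UV` only.  Restate-immune (no Theses import).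
-/

set_option autoImplicit false

noncomputable section
open scoped BigOperators Matrix

namespace Summit.QuantumFields.YangMills.BalabanUVNodes.N15.Gluing

open Literature.MathematicalPhysics.QuantumFieldTheory.Balaban1983to89
open Literature.MathematicalPhysics.QuantumFieldTheory.Balaban1983to89.B6Prop26Gluing (mulOp mulOp_apply)
open Summit.QuantumFields.YangMills.BalabanUVNodes.N15.MatrixSpecies (mmulOp liftBlk liftEquiv mmulOp_comp_mmulOp)
open Summit.QuantumFields.YangMills.BalabanUVNodes.N15.BackgroundLayer (fgrad bgrad stack projO unstackM bgPropV fgradMat)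

/-! ## §1 The conjugated gradients as covariant-shaped entries -/

section Algebra

variable {X ι : Type} [Fintype ι] [DecidableEq ι]

omit [DecidableEq ι] in
/-- `M_W∘∇⁻_e∘M_{Wᵀ} = M_{R₁}∘∇⁻_e + M_{B₁}`, `R₁(x) = W(x)W(e⁻¹x)ᵀ`, `B₁(x) = W(x)·∇_e(Wᵀ∘e⁻¹)(x)` (FILE 150 `mmulOp_comp_bgrad_eq` at `B := Wᵀ∘e⁻¹`, then `M_WM_C = M_{WC}`).
[cite: Balaban1985BackgroundPropagators, (3.34)–(3.35) p.396 (the per-cube gauge), (3.42) p.397 (entry 2: shape)] -/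
theorem gaugeConj_bgrad_eq (n : ℝ) (e : X ≃ X) (W : X → Matrix ι ι ℝ) :
    mmulOp W ∘ₗ bgrad n (liftEquiv e ι) ∘ₗ mmulOp (fun x => (W x)ᵀ) =
      mmulOp (fun x => W x * (W (e.symm x))ᵀ) ∘ₗ bgrad n (liftEquiv e ι) + mmulOp (fun x => W x * fgradMat n e (fun y => (W (e.symm y))ᵀ) x) := by
  have h := mmulOp_comp_bgrad_eq n e (fun y => (W (e.symm y))ᵀ)
  have hWe : ((fun y => (W (e.symm y))ᵀ) ∘ ⇑e) = fun x => (W x)ᵀ := funext fun x => by simp only [Function.comp_apply, Equiv.symm_apply_apply]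
  rw [hWe] at h
  have h2 : bgrad n (liftEquiv e ι) ∘ₗ mmulOp (fun x => (W x)ᵀ) = mmulOp (fun y => (W (e.symm y))ᵀ) ∘ₗ bgrad n (liftEquiv e ι) + mmulOp (fgradMat n e (fun y => (W (e.symm y))ᵀ)) := by
    rw [← sub_eq_iff_eq_add.mp h.symm]
  rw [h2, LinearMap.comp_add, ← LinearMap.comp_assoc, mmulOp_comp_mmulOp, mmulOp_comp_mmulOp]

omit [DecidableEq ι] in
/-- `M_W∘∇⁺_e∘M_{Wᵀ} = M_{R₁}∘∇⁺_e + M_{B₁}`, `R₁(x) = W(x)W(ex)ᵀ`, `B₁(x) = W(x)·(∇_e(Wᵀ∘e))(e⁻¹x)` (FILE 150 `mmulOp_comp_fgrad_eq` at `A := Wᵀ∘e`).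
[cite: Balaban1985BackgroundPropagators, (3.34)–(3.35) p.396, (3.42) p.397 (shapes)] -/
theorem gaugeConj_fgrad_eq (n : ℝ) (e : X ≃ X) (W : X → Matrix ι ι ℝ) :
    mmulOp W ∘ₗ fgrad n (liftEquiv e ι) ∘ₗ mmulOp (fun x => (W x)ᵀ) =
      mmulOp (fun x => W x * (W (e x))ᵀ) ∘ₗ fgrad n (liftEquiv e ι) + mmulOp (fun x => W x * (fgradMat n e (fun y => (W (e y))ᵀ) ∘ ⇑e.symm) x) := by
  have h := mmulOp_comp_fgrad_eq n e (fun y => (W (e y))ᵀ)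
  have hWe : ((fun y => (W (e y))ᵀ) ∘ ⇑e.symm) = fun x => (W x)ᵀ := funext fun x => by simp only [Function.comp_apply, Equiv.apply_symm_apply]
  rw [hWe] at h
  have h2 : fgrad n (liftEquiv e ι) ∘ₗ mmulOp (fun x => (W x)ᵀ) = mmulOp (fun y => (W (e y))ᵀ) ∘ₗ fgrad n (liftEquiv e ι) + mmulOp (fgradMat n e (fun y => (W (e y))ᵀ) ∘ ⇑e.symm) := by
    rw [← sub_eq_iff_eq_add.mp h.symm]
  rw [h2, LinearMap.comp_add, ← LinearMap.comp_assoc, mmulOp_comp_mmulOp, mmulOp_comp_mmulOp]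

variable {χX : X → ℝ}

omit [DecidableEq ι] in
/-- ★ **THE CONJUGATED BACKWARD GRADIENT IS SANDWICHED**: `G∘∇⁻∘M_χ = T∘M_χ` ⟹ `G∘(M_W∇⁻M_{Wᵀ})∘M_χ = (T∘M_{R₁∘e} − G∘M_{∇R₁} + G∘M_{B₁})∘M_χ` (§1 + FILE 157 ★ `comp_covShape_bgrad_sandwich`).
[cite: Balaban1985BackgroundPropagators, (3.34)–(3.35) p.396, (3.42) p.397, (3.64)–(3.65) pp.402–403 (shapes)] -/
theorem comp_gaugeConj_bgrad_sandwich (n : ℝ) (e : X ≃ X) (W : X → Matrix ι ι ℝ) {G T : (X × ι → ℝ) →ₗ[ℝ] (X × ι → ℝ)}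
    (hT : G ∘ₗ bgrad n (liftEquiv e ι) ∘ₗ mulOp (fun p : X × ι => χX p.1) = T ∘ₗ mulOp (fun p : X × ι => χX p.1)) :
    G ∘ₗ (mmulOp W ∘ₗ bgrad n (liftEquiv e ι) ∘ₗ mmulOp (fun x => (W x)ᵀ)) ∘ₗ mulOp (fun p : X × ι => χX p.1) =
      (T ∘ₗ mmulOp ((fun x => W x * (W (e.symm x))ᵀ) ∘ e) - G ∘ₗ mmulOp (fgradMat n e (fun x => W x * (W (e.symm x))ᵀ)) +
        G ∘ₗ mmulOp (fun x => W x * fgradMat n e (fun y => (W (e.symm y))ᵀ) x)) ∘ₗ mulOp (fun p : X × ι => χX p.1) := by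
  rw [gaugeConj_bgrad_eq]
  exact comp_covShape_bgrad_sandwich n e _ _ hT

omit [DecidableEq ι] in
/-- ★ **… IN FILE 160's `hE2′` SHAPE**: with `χ = 1` on `supp a`, `M_c∘G∘(M_W∇⁻M_{Wᵀ})∘M_a = (M_c∘T₂)∘M_a`, `T₂ = T∘M_{R₁∘e} − G∘M_{∇R₁} + G∘M_{B₁}` (FILE 157 `cut_sandwich_of_sandwich`).
[cite: Balaban1985BackgroundPropagators, (3.34)–(3.35) p.396, (3.42) p.397 (shapes)] -/
theorem cut_gaugeConj_bgrad_sandwich (n : ℝ) (e : X ≃ X) (W : X → Matrix ι ι ℝ) {G T : (X × ι → ℝ) →ₗ[ℝ] (X × ι → ℝ)} {a c : X × ι → ℝ}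
    (hT : G ∘ₗ bgrad n (liftEquiv e ι) ∘ₗ mulOp (fun p : X × ι => χX p.1) = T ∘ₗ mulOp (fun p : X × ι => χX p.1)) (ha : ∀ p, a p ≠ 0 → χX p.1 = 1) :
    mulOp c ∘ₗ G ∘ₗ (mmulOp W ∘ₗ bgrad n (liftEquiv e ι) ∘ₗ mmulOp (fun x => (W x)ᵀ)) ∘ₗ mulOp a =
      (mulOp c ∘ₗ (T ∘ₗ mmulOp ((fun x => W x * (W (e.symm x))ᵀ) ∘ e) - G ∘ₗ mmulOp (fgradMat n e (fun x => W x * (W (e.symm x))ᵀ)) +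
        G ∘ₗ mmulOp (fun x => W x * fgradMat n e (fun y => (W (e.symm y))ᵀ) x))) ∘ₗ mulOp a :=
  cut_sandwich_of_sandwich (comp_gaugeConj_bgrad_sandwich n e W hT) ha

end Algebra

/-! ## §2 The instance: the adjoint-side dressed smooth-cut cube -/

section Instance

variable {X ι J : Type} [Fintype X] [DecidableEq X] [Fintype ι] [DecidableEq ι] [Fintype J] [DecidableEq J] (τ : J → X ≃ X) (n : ℝ)
  {N : (X × ι → ℝ) →ₗ[ℝ] (X × ι → ℝ)} {χX χtX : X → ℝ}

/-- ★★ **FILE 160's SANDWICH HYPOTHESIS FOR THE ADJOINT-SIDE DRESSED CUBE AND `E := ∇⁻_e` IN THE CUBE's GAUGE `W`**: from the flat cube's sandwich `N∘∇⁻_e∘M_χ = T∘M_χ` (dag-n15-a N-IIn (a)⁻ shape),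
the units, `M_χM_χ̃ = M_χ̃`, and `χ = 1` on `supp a`:  `M_c∘X°∘(M_W∇⁻_eM_{Wᵀ})∘M_a = (M_c∘T₂)∘M_a` with
`T₂ = (Ñ_𝒲∘M_χ̃∘T)∘M_{R₁∘e} − X°∘M_{∇R₁} + X°∘M_{B₁}`. [cite: Balaban1985BackgroundPropagators, (3.34)–(3.35) p.396, (3.42) p.397 (entry 2), (3.64)–(3.65) pp.402–403 (shapes)] -/
theorem smoothCutDressed_gaugeConj_bgrad_sandwich {D : J ⊕ J → (X × ι → ℝ) →ₗ[ℝ] (X × ι → ℝ)} {V : ((X × ι) × Option (J ⊕ J) → ℝ) →ₗ[ℝ] (X × ι → ℝ)}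
    (hD : ∀ j, D j = (fun j => Sum.elim (fun μ => fgrad n (liftEquiv (τ μ) ι)) (fun μ => bgrad n (liftEquiv (τ μ) ι)) j) j ∘ₗ (mulOp (fun p : X × ι => χtX p.1) ∘ₗ N))
    (hunit : IsUnit (1 - LinearMap.toMatrix' (stack (mulOp (fun p : X × ι => χtX p.1) ∘ₗ N) D ∘ₗ V)))
    (hχ : mulOp (fun p : X × ι => χX p.1) ∘ₗ mulOp (fun p : X × ι => χtX p.1) = mulOp (fun p : X × ι => χtX p.1))
    (hunitW : IsUnit (1 - LinearMap.toMatrix' ((mulOp (fun p : X × ι => χtX p.1) ∘ₗ N) ∘ₗ V ∘ₗ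
      stack LinearMap.id (fun j => Sum.elim (fun μ => fgrad n (liftEquiv (τ μ) ι)) (fun μ => bgrad n (liftEquiv (τ μ) ι)) j) ∘ₗ mulOp (fun p : X × ι => χX p.1))))
    (e : X ≃ X) (W : X → Matrix ι ι ℝ) {T : (X × ι → ℝ) →ₗ[ℝ] (X × ι → ℝ)} (hT : N ∘ₗ bgrad n (liftEquiv e ι) ∘ₗ mulOp (fun p : X × ι => χX p.1) = T ∘ₗ mulOp (fun p : X × ι => χX p.1))
    {a c : X × ι → ℝ} (ha : ∀ p, a p ≠ 0 → χX p.1 = 1) :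
    mulOp c ∘ₗ (projO none ∘ₗ bgPropV (stack (mulOp (fun p : X × ι => χtX p.1) ∘ₗ N) D) V) ∘ₗ (mmulOp W ∘ₗ bgrad n (liftEquiv e ι) ∘ₗ mmulOp (fun x => (W x)ᵀ)) ∘ₗ mulOp a =
      (mulOp c ∘ₗ ((neumannR ((mulOp (fun p : X × ι => χtX p.1) ∘ₗ N) ∘ₗ V ∘ₗ
              stack LinearMap.id (fun j => Sum.elim (fun μ => fgrad n (liftEquiv (τ μ) ι)) (fun μ => bgrad n (liftEquiv (τ μ) ι)) j) ∘ₗ mulOp (fun p : X × ι => χX p.1)) ∘ₗ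
            (mulOp (fun p : X × ι => χtX p.1) ∘ₗ T)) ∘ₗ mmulOp ((fun x => W x * (W (e.symm x))ᵀ) ∘ e) -
          (projO none ∘ₗ bgPropV (stack (mulOp (fun p : X × ι => χtX p.1) ∘ₗ N) D) V) ∘ₗ mmulOp (fgradMat n e (fun x => W x * (W (e.symm x))ᵀ)) +
          (projO none ∘ₗ bgPropV (stack (mulOp (fun p : X × ι => χtX p.1) ∘ₗ N) D) V) ∘ₗ mmulOp (fun x => W x * fgradMat n e (fun y => (W (e.symm y))ᵀ) x))) ∘ₗ mulOp a :=
  cut_gaugeConj_bgrad_sandwich n e W (smoothCutDressed_comp_grad_sandwich τ n hD hunit hχ hunitW hT) ha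

end Instance

end Summit.QuantumFields.YangMills.BalabanUVNodes.N15.Gluing

end
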